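import Mathlib
import Summits.Ventures.PercRepro2.Harris
import Summits.Ventures.PercRepro2.BasePrime
import Summits.Ventures.PercRepro2.LocRows
import Summits.Ventures.PercRepro2.SwRow
import Summits.Ventures.PercRepro2.SwOut
import Summits.Ventures.PercRepro2.SwOutStarDefs

/-!
# The star classes of statement (HLC) are theorems, part 2: Harris + the colour swap at `h`
(blind cell PercRepro2, night-4 g9, 2026-08-25; proofs/NIGHT4-G9.md §8; vocabulary in `SwOutStarDefs`)

Take `U = N[h]`, the closed neighbourhood of `h`, with `N(h)` INDEPENDENT (no edge among the
neighbours, no loops there, at most one edge `h–x`), `l ∉ U`, and a colouring `ξ` of the edges not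
touching `U`.  On the outside class `outClass U h ξ` every neighbour `x` of `h` lies in exactly one of
`C_R(h)`, `C_B(h)` and its outside edges carry the colour OPPOSITE to `hx`; so the class is the cube
of colourings of the star of `h` (`starRealize`), with `C_B(h) = {h} ∪ S`, `C_R(h) = {h} ∪ Sᶜ` for
`S` = the blue star edges.  Given `ξ`, `o ∈ C_R(l)` is increasing in `S` (the blue star edges make
their neighbours RED connectors) and `o ∈ C_B(l)` decreasing, so `Q` is a lower set of the star cube
(red = `true`); Harris on the cube and the swap `ω ↦ blue ω` give the counting inequality of (HLC) on
the class, and Hall gives the injection.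

* `cluster_l_starRealize` / `cluster_blue_l_starRealize` — the clusters of `l` do not see the star;
* `isLowerSet_starQ`, `isUpperSet_starT`, `isLowerSet_starTp` — the monotonicity in the star colouring;
* **`card_cube_le_of_isLowerSet`** / `card_cube_le` — Harris on the star cube (for every lower set
  of the cube; for `Q`);
* `filter_outClass_eq` / `filter_swOutSide_eq` — the class pieces are images of the cube pieces.
Part 3 (`SwOutStarThm.lean`): the counting inequality on the class, Hall, and the theorems
`swOut_star` (for `Q`) and `swOut_star_pair` (for any up-set of pairs `(C_R(l), C_B(l))`).
-/

namespace Summit.Ventures.PercRepro2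

namespace LocRows

open Hull

variable {V : Type*} {E : Type*} [Fintype E] [DecidableEq E] [DecidableEq V]

open scoped Classical

variable {ends : E → Sym2 V}

/-! ## Monotonicity in the star colouring -/

omit [Fintype E] [DecidableEq E] [DecidableEq V] in
/-- A vertex with no open edge is alone in its cluster. -/
lemma notMem_cluster_of_isolated {ω : Config E} {v u : V} (hvu : v ≠ u)
    (hiso : ∀ e, v ∈ ends e → ω e = false) : v ∉ cluster ends ω u := by
  intro hv
  have hc : Conn ends ω u v := hv
  rw [Conn, SimpleGraph.reachable_iff_reflTransGen] at hc
  rcases Relation.ReflTransGen.cases_tail hc with h | ⟨y, _, hyv⟩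
  · exact hvu h
  · obtain ⟨_, e, he, hends⟩ := openGraph_adj.1 hyv
    have := hiso e (by rw [hends]; exact Sym2.mem_mk_right _ _)
    rw [he] at this
    exact Bool.noConfusion this

omit [Fintype E] [DecidableEq E] [DecidableEq V] in
/-- The star colouring is monotone: the red side grows. -/
lemma redStar_mono {h : V} (hs : IsStarAt ends h) {ω₁ ω₂ : Config (StarEdge ends h)}
    (hω : ω₁ ≤ ω₂) : redStar hs ω₁ ⊆ redStar hs ω₂ := by
  rintro x (rfl | ⟨hx, hx'⟩)
  · exact Or.inl rfl
  · refine Or.inr ⟨hx, ?_⟩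
    have := hω (starEdge hs hx)
    rw [hx'] at this
    exact Bool.eq_true_of_true_le this

omit [Fintype E] [DecidableEq E] [DecidableEq V] in
/-- The blue side shrinks. -/
lemma blueStar_anti {h : V} (hs : IsStarAt ends h) {ω₁ ω₂ : Config (StarEdge ends h)}
    (hω : ω₁ ≤ ω₂) : blueStar hs ω₂ ⊆ blueStar hs ω₁ := by
  rintro x (rfl | ⟨hx, hx'⟩)
  · exact Or.inl rfl
  · refine Or.inr ⟨hx, ?_⟩
    have := hω (starEdge hs hx)
    rw [hx'] at this
    exact Bool.eq_false_of_le_false this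

/-- The realisation with every star edge set to the constant colour `c` (the clusters of `l` do not
see the star edges). -/
noncomputable def starConst {h : V} (hs : IsStarAt ends h) (ξ : Config E) (c : Bool)
    (ω : Config (StarEdge ends h)) : Config E :=
  fun e => if h ∈ ends e then c else starRealize hs ξ ω e

omit [Fintype E] [DecidableEq E] in
/-- The red cluster of `l ∉ N[h]` in the realisation is its red cluster with the star set blue. -/
lemma cluster_l_starRealize {h l : V} (hs : IsStarAt ends h) (ξ : Config E)
    (ω : Config (StarEdge ends h)) (hl : l ∉ closedNbr ends h) :
    cluster ends (starRealize hs ξ ω) l = cluster ends (starConst hs ξ false ω) l := by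
  refine cluster_eq_of_eqOn_touches (ω := starConst hs ξ false ω) (ω' := starRealize hs ξ ω) ?_ rfl
  intro e he
  by_cases hh : h ∈ ends e
  · -- a star edge touching the cluster of `l`: its neighbour endpoint has a blue star edge
    obtain ⟨x, hxn, hx⟩ := exists_nbr_of_star hs ⟨e, hh⟩
    simp only at hx
    have hlh : l ≠ h := fun h' => hl (by rw [mem_closedNbr]; exact Or.inl h')
    have hlx : l ≠ x := fun h' => hl (by rw [mem_closedNbr]; exact Or.inr (h' ▸ hxn))
    -- `h` is isolated in `starConst … false`
    have hhiso : h ∉ cluster ends (starConst hs ξ false ω) l :=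
      notMem_cluster_of_isolated hlh.symm fun e' he' => by simp [starConst, he']
    obtain ⟨y, hy, z, hyz⟩ := mem_touches.1 he
    rw [hx] at hyz
    -- the endpoints of `e` are `h` and `x`
    have hmem : y = h ∨ y = x := by
      have : y ∈ s(h, x) := by rw [hyz]; exact Sym2.mem_mk_left _ _
      exact Sym2.mem_iff.1 this
    rcases hmem with rfl | rfl
    · exact absurd hy hhiso
    · -- `x` lies in the cluster of `l`: its star edge must be blue, else `x` is isolated
      have hxc : ω (starEdge hs hxn) = false := by
        by_contra hne
        have hred : ω (starEdge hs hxn) = true := by simpa using hne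
        refine notMem_cluster_of_isolated hlx.symm (fun e' he' => ?_) hy
        by_cases hh' : h ∈ ends e'
        · simp [starConst, hh']
        · simp only [starConst, hh', if_false]
          rw [starRealize_bnd hs ξ ω hh' hxn he', hred]; rfl
      have heq : (⟨e, hh⟩ : StarEdge ends h) = starEdge hs hxn := eq_starEdge hs hxn hx
      simp only [starConst, hh, if_true, starRealize_star hs ξ ω hh, heq, hxc]
  · simp [starConst, hh]

omit [Fintype E] [DecidableEq E] in
/-- The blue cluster of `l ∉ N[h]` in the realisation is its blue cluster with the star set red. -/
lemma cluster_blue_l_starRealize {h l : V} (hs : IsStarAt ends h) (ξ : Config E)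
    (ω : Config (StarEdge ends h)) (hl : l ∉ closedNbr ends h) :
    cluster ends (blue (starRealize hs ξ ω)) l =
      cluster ends (blue (starConst hs ξ true ω)) l := by
  refine cluster_eq_of_eqOn_touches (ω := blue (starConst hs ξ true ω))
    (ω' := blue (starRealize hs ξ ω)) ?_ rfl
  intro e he
  by_cases hh : h ∈ ends e
  · obtain ⟨x, hxn, hx⟩ := exists_nbr_of_star hs ⟨e, hh⟩
    simp only at hx
    have hlh : l ≠ h := fun h' => hl (by rw [mem_closedNbr]; exact Or.inl h')
    have hlx : l ≠ x := fun h' => hl (by rw [mem_closedNbr]; exact Or.inr (h' ▸ hxn))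
    have hhiso : h ∉ cluster ends (blue (starConst hs ξ true ω)) l :=
      notMem_cluster_of_isolated hlh.symm fun e' he' => by simp [blue_apply, starConst, he']
    obtain ⟨y, hy, z, hyz⟩ := mem_touches.1 he
    rw [hx] at hyz
    have hmem : y = h ∨ y = x := by
      have : y ∈ s(h, x) := by rw [hyz]; exact Sym2.mem_mk_left _ _
      exact Sym2.mem_iff.1 this
    rcases hmem with rfl | rfl
    · exact absurd hy hhiso
    · have hxc : ω (starEdge hs hxn) = true := by
        by_contra hne
        have hblue : ω (starEdge hs hxn) = false := by simpa using hne
        refine notMem_cluster_of_isolated hlx.symm (fun e' he' => ?_) hy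
        by_cases hh' : h ∈ ends e'
        · simp [blue_apply, starConst, hh']
        · simp only [blue_apply, starConst, hh', if_false]
          rw [starRealize_bnd hs ξ ω hh' hxn he', hblue]; rfl
      have heq : (⟨e, hh⟩ : StarEdge ends h) = starEdge hs hxn := eq_starEdge hs hxn hx
      simp only [blue_apply, starConst, hh, if_true, starRealize_star hs ξ ω hh, heq, hxc]
  · simp [blue_apply, starConst, hh]

omit [Fintype E] [DecidableEq E] in
/-- `starConst c` is antitone in the star colouring (the boundary colours are the opposites). -/
lemma starConst_anti {h : V} (hs : IsStarAt ends h) (ξ : Config E) (c : Bool)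
    {ω₁ ω₂ : Config (StarEdge ends h)} (hω : ω₁ ≤ ω₂) :
    starConst hs ξ c ω₂ ≤ starConst hs ξ c ω₁ := by
  intro e
  by_cases hh : h ∈ ends e
  · simp [starConst, hh]
  · simp only [starConst, hh, if_false]
    by_cases hx : ∃ x, x ∈ nbr ends h ∧ x ∈ ends e
    · obtain ⟨x, hx, hxe⟩ := hx
      rw [starRealize_bnd hs ξ ω₂ hh hx hxe, starRealize_bnd hs ξ ω₁ hh hx hxe]
      have := hω (starEdge hs hx)
      revert this
      cases ω₁ (starEdge hs hx) <;> cases ω₂ (starEdge hs hx) <;> simp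
    · have hn : ∀ x ∈ nbr ends h, x ∉ ends e := fun x hx' hxe => hx ⟨x, hx', hxe⟩
      rw [starRealize_out hs ξ ω₂ hh hn, starRealize_out hs ξ ω₁ hh hn]

omit [Fintype E] [DecidableEq E] [DecidableEq V] in
/-- The colour swap reverses the order. -/
lemma blue_le_blue_of_le {ω ω' : Config E} (h : ω ≤ ω') : blue ω' ≤ blue ω := by
  intro e
  have := h e
  simp only [blue_apply]
  revert this
  cases ω e <;> cases ω' e <;> simp

omit [Fintype E] [DecidableEq E] [DecidableEq V] in
/-- The blue side of the swapped star colouring is the red side. -/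
lemma blueStar_blue {h : V} (hs : IsStarAt ends h) (ω : Config (StarEdge ends h)) :
    blueStar hs (blue ω) = redStar hs ω := by
  ext x
  simp only [blueStar, redStar, Set.mem_setOf_eq, blue_apply, Bool.not_eq_false']

/-! ## The events on the star cube -/

section Events

variable {h l o : V} (hs : IsStarAt ends h) (ξ : Config E)

/-- `Q` pulled back to the star cube. -/
def starQ (l o : V) : Set (Config (StarEdge ends h)) :=
  {ω | starRealize hs ξ ω ∈ tgtU ends l h {S : Set V | o ∈ S}}

/-- `{C_R(h) ∈ 𝓥}` pulled back. -/
def starT (𝓥 : Set (Set V)) : Set (Config (StarEdge ends h)) :=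
  {ω | cluster ends (starRealize hs ξ ω) h ∈ 𝓥}

/-- `{C_B(h) ∈ 𝓥}` pulled back. -/
def starTp (𝓥 : Set (Set V)) : Set (Config (StarEdge ends h)) :=
  {ω | cluster ends (blue (starRealize hs ξ ω)) h ∈ 𝓥}

omit [Fintype E] [DecidableEq E] in
/-- `{C_R(h) ∈ 𝓥}` is increasing in the star colouring. -/
lemma isUpperSet_starT {𝓥 : Set (Set V)} (h𝓥 : IsUpperSet 𝓥) : IsUpperSet (starT hs ξ 𝓥) := by
  intro ω₁ ω₂ hω h₁
  simp only [starT, Set.mem_setOf_eq, cluster_starRealize] at h₁ ⊢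
  exact h𝓥 (redStar_mono hs hω) h₁

omit [Fintype E] [DecidableEq E] in
/-- `{C_B(h) ∈ 𝓥}` is decreasing in the star colouring. -/
lemma isLowerSet_starTp {𝓥 : Set (Set V)} (h𝓥 : IsUpperSet 𝓥) : IsLowerSet (starTp hs ξ 𝓥) := by
  intro ω₂ ω₁ hω h₂
  simp only [starTp, Set.mem_setOf_eq, cluster_blue_starRealize] at h₂ ⊢
  exact h𝓥 (blueStar_anti hs hω) h₂

omit [Fintype E] [DecidableEq E] in
/-- `h` never lies in the hull of `l ∉ N[h]` on the class. -/
lemma h_notMem_hull_starRealize (hl : l ∉ closedNbr ends h) (ω : Config (StarEdge ends h)) :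
    h ∉ hull ends (starRealize hs ξ ω) l := by
  intro hh
  have : l ∈ hull ends (starRealize hs ξ ω) h := by
    rcases hh with hh | hh
    · exact Or.inl (conn_symm hh)
    · exact Or.inr (conn_symm hh)
  rw [hull, cluster_starRealize, cluster_blue_starRealize] at this
  apply hl
  rw [mem_closedNbr]
  rcases this with (rfl | ⟨hx, _⟩) | (rfl | ⟨hx, _⟩)
  · exact Or.inl rfl
  · exact Or.inr hx
  · exact Or.inl rfl
  · exact Or.inr hx

/-- `Q` is a lower set of the star cube: the blue star edges make their neighbours red connectors. -/
lemma isLowerSet_starQ (hl : l ∉ closedNbr ends h) : IsLowerSet (starQ hs ξ l o) := by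
  intro ω₂ ω₁ hω h₂
  simp only [starQ, Set.mem_setOf_eq, tgtU, Finset.mem_filter, Finset.mem_univ, true_and] at h₂ ⊢
  obtain ⟨_, hA, hB⟩ := h₂
  refine ⟨h_notMem_hull_starRealize hs ξ hl ω₁, ?_, ?_⟩
  · rw [cluster_l_starRealize hs ξ ω₁ hl]
    rw [cluster_l_starRealize hs ξ ω₂ hl] at hA
    exact cluster_mono (starConst_anti hs ξ false hω) l hA
  · rw [cluster_blue_l_starRealize hs ξ ω₁ hl]
    rw [cluster_blue_l_starRealize hs ξ ω₂ hl] at hB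
    intro ho
    exact hB (cluster_mono (blue_le_blue_of_le (starConst_anti hs ξ true hω)) l ho)

omit [Fintype E] [DecidableEq E] in
/-- The global swap of the star cube exchanges the two cluster events. -/
lemma flipAll_preimage_starTp (𝓥 : Set (Set V)) :
    flipAll ⁻¹' (starTp hs ξ 𝓥) = starT hs ξ 𝓥 := by
  ext ω
  simp only [Set.mem_preimage, starTp, starT, Set.mem_setOf_eq, cluster_blue_starRealize,
    cluster_starRealize]
  have : (flipAll ω : Config (StarEdge ends h)) = blue ω := rfl
  rw [this, blueStar_blue]

end Events

/-! ## Harris on the star cube and the counting inequality on the class -/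

section Count

variable {h l o : V} (hs : IsStarAt ends h) (ξ : Config E)

/-- The uniform probability of an event of the star cube is its size over `2^d`. -/
lemma prob_half_eq_card (A : Set (Config (StarEdge ends h))) :
    prob (half (E := StarEdge ends h) (R := ℚ)) A =
      (1 / 2 : ℚ) ^ Fintype.card (StarEdge ends h) * ((Finset.univ.filter (· ∈ A)).card : ℚ) := by
  rw [prob_eq_sum_filter]
  simp only [weight_half, Finset.sum_const, nsmul_eq_mul]
  ring

/-- **Harris on the star cube**: for every lower set `Ev` of the star cube,
`#(Ev ∩ {C_R(h) ∈ 𝓥}) ≤ #(Ev ∩ {C_B(h) ∈ 𝓥})`. -/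
theorem card_cube_le_of_isLowerSet {Ev : Set (Config (StarEdge ends h))} (hEv : IsLowerSet Ev)
    {𝓥 : Set (Set V)} (h𝓥 : IsUpperSet 𝓥) :
    (Finset.univ.filter (· ∈ Ev ∩ starT hs ξ 𝓥)).card ≤
      (Finset.univ.filter (· ∈ Ev ∩ starTp hs ξ 𝓥)).card := by
  have hp : IsProbVec (half (E := StarEdge ends h) (R := ℚ)) := isProbVec_half
  have h1 := prob_inter_le_prob_mul_prob_of_isLowerSet hp hEv (isUpperSet_starT hs ξ h𝓥)
  have h2 := prob_mul_prob_le_prob_inter_of_isLowerSet hp hEv (isLowerSet_starTp hs ξ h𝓥)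
  have h3 : prob (half (E := StarEdge ends h) (R := ℚ)) (starT hs ξ 𝓥) =
      prob half (starTp hs ξ 𝓥) := by
    rw [← flipAll_preimage_starTp hs ξ 𝓥, prob_half_flipAll]
  have key : prob (half (E := StarEdge ends h) (R := ℚ)) (Ev ∩ starT hs ξ 𝓥) ≤
      prob half (Ev ∩ starTp hs ξ 𝓥) := by
    calc prob (half (E := StarEdge ends h) (R := ℚ)) (Ev ∩ starT hs ξ 𝓥)
        ≤ prob half Ev * prob half (starT hs ξ 𝓥) := h1
      _ = prob half Ev * prob half (starTp hs ξ 𝓥) := by rw [h3]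
      _ ≤ prob half (Ev ∩ starTp hs ξ 𝓥) := h2
  rw [prob_half_eq_card, prob_half_eq_card] at key
  have hpos : (0 : ℚ) < (1 / 2 : ℚ) ^ Fintype.card (StarEdge ends h) := by positivity
  have h4 := le_of_mul_le_mul_left key hpos
  norm_cast at h4
  convert h4

/-- Harris on the star cube for `Q`. -/
theorem card_cube_le (hl : l ∉ closedNbr ends h) {𝓥 : Set (Set V)} (h𝓥 : IsUpperSet 𝓥) :
    (Finset.univ.filter (· ∈ starQ hs ξ l o ∩ starT hs ξ 𝓥)).card ≤
      (Finset.univ.filter (· ∈ starQ hs ξ l o ∩ starTp hs ξ 𝓥)).card :=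
  card_cube_le_of_isLowerSet hs ξ (isLowerSet_starQ hs ξ (o := o) hl) h𝓥

/-- A filtered piece of the outside class is the image of the corresponding piece of the star cube. -/
lemma filter_outClass_eq (P : Config E → Prop) :
    (outClass ends (closedNbr ends h) h ξ).filter P =
      (Finset.univ.filter fun ω => P (starRealize hs ξ ω)).image (starRealize hs ξ) := by
  ext ζ
  simp only [Finset.mem_filter, Finset.mem_image, Finset.mem_univ, true_and]
  constructor
  · rintro ⟨hζ, hP⟩
    have heq := eq_starRealize_of_mem_outClass hs ξ hζ
    exact ⟨fun e => ζ e.1, by rw [← heq]; exact hP, heq.symm⟩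
  · rintro ⟨ω, hP, rfl⟩
    exact ⟨starRealize_mem_outClass hs ξ ω, hP⟩

/-- A filtered piece of the class `Q ∩ outClass` is the image of the corresponding piece of the
star cube. -/
lemma filter_swOutSide_eq (P : Config E → Prop) :
    (swOutSide ends l h o (closedNbr ends h) ξ).filter P =
      (Finset.univ.filter fun ω => ω ∈ starQ hs ξ l o ∧ P (starRealize hs ξ ω)).image
        (starRealize hs ξ) := by
  ext ζ
  simp only [Finset.mem_filter, Finset.mem_image, Finset.mem_univ, true_and]
  constructor
  · rintro ⟨hζ, hP⟩
    have hζ' := hζ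
    rw [mem_swOutSide] at hζ'
    have heq := eq_starRealize_of_mem_outClass hs ξ hζ'.2
    refine ⟨fun e => ζ e.1, ⟨?_, ?_⟩, heq.symm⟩
    · simp only [starQ, Set.mem_setOf_eq]; rw [← heq]; exact hζ'.1
    · rw [← heq]; exact hP
  · rintro ⟨ω, ⟨hQ, hP⟩, rfl⟩
    refine ⟨?_, hP⟩
    rw [mem_swOutSide]
    exact ⟨hQ, starRealize_mem_outClass hs ξ ω⟩

end Count

end LocRows

end Summit.Ventures.PercRepro2
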